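import Summits.QuantumAdvantage.AdviceFreeQNC0.AffBells23NearPerfect
import Summits.QuantumAdvantage.AdviceFreeQNC0.HiddenCoins
import HarnessLib

/-!
# The antipodal 2-junta at small `N`: kernel-certified win counts, `AntipodalValueFormula` at `N = 6, 8`, and
# **`AntipodalLeThreeQuarters` AS TYPED IS FALSE** (`N = 6`: 26 of the 32 odd inputs are won, `26 > 24`)

Planner qn-p1 g23's ROUND-22 §2.8 / `AffBells23NearPerfect.lean` §3 (ask P-23h) types two targets for the antipodal affine MOD₃ bell
strategy `z_b(x) = [x_{b+1} + x_{b+N/2} ≡ 1 (3)]` on the even `N`-cycle: the closed form `AntipodalValueFormula`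
(`4·wins(N) = 2^N + a_{N/2} − (−2)^{N/2} − b_{N/2}`) and the corollary `AntipodalLeThreeQuarters` (`4·wins(N) ≤ 3·2^{N−1}` for every even
`N ≥ 6`).  Here (prover seat qn-prover-3 g13) the win count `affWinCard (antipodalRows N) 1` is EVALUATED IN THE KERNEL (standard axioms,
`decide +kernel`; the cube `Fin N → Bool` and the kernel-vector quantifier of `RingHLF.Rel` are enumerated structurally by `Fin.cons` —
`FreePhase.countCoins` of `HiddenCoins.lean` and `allCoins` below — so no `Fintype` instance of a function space is unfolded):

* `antipodal_wins_six : affWinCard (antipodalRows 6) 1 = 26`, `antipodal_wins_eight : affWinCard (antipodalRows 8) 1 = 88` — both agree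
  with the closed form (`antipodalValueFormula_six/eight`: `64 + 45 + 8 − 13 = 104 = 4·26`, `256 + 161 − 16 − 49 = 352 = 4·88`);
* **`not_antipodalLeThreeQuarters : ¬ AntipodalLeThreeQuarters`** — at `N = 6` the strategy wins `26/32 = 0.8125 > 3/4` of the odd inputs
  (`4·26 = 104 > 96 = 3·2⁵`); the planner's "max `0.746` at `N = 10`" holds from `N = 8` on (`N = 8: 0.6875`, `10: 0.746`, `12: 0.705`,
  then ↓ `1/2`).  The repaired target is `AntipodalLeThreeQuartersFrom8` (`8 ≤ N`, otherwise verbatim), stated here for P-23h.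

WHAT THIS IS NOT: the closed form for all `N` (P-23h (ii)–(iii): the 16-state folded transfer matrix) is NOT proved here; instrument for
crux stmt-QuantumAdvantage-22907 (route DWalkThree); separation NOT moved.
-/

namespace Summit.QuantumAdvantage.AdviceFreeQNC0

namespace AffBells23

open Finset Literature.Computability.QuantumComplexity

/-! ### Structural enumeration of the coin cube (kernel-reducible) -/

/-- Conjunction of a Boolean test over ALL `Fin m → Bool`, enumerated by `Fin.cons`. -/
def allCoins : (m : ℕ) → ((Fin m → Bool) → Bool) → Bool
  | 0, P => P fun i => i.elim0
  | m + 1, P =>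
      allCoins m (fun x => P (Fin.cons (α := fun _ => Bool) false x)) &&
        allCoins m (fun x => P (Fin.cons (α := fun _ => Bool) true x))

/-- `allCoins m P` certifies `P` on every coin vector, and conversely. -/
theorem allCoins_eq_true_iff : ∀ (m : ℕ) (P : (Fin m → Bool) → Bool), allCoins m P = true ↔ ∀ x, P x = true
  | 0, P => by
      constructor
      · intro h x
        have e : x = fun i => i.elim0 := funext fun i => i.elim0
        rw [e]; exact h
      · intro h; exact h _
  | m + 1, P => by
      simp only [allCoins, Bool.and_eq_true]
      rw [allCoins_eq_true_iff m, allCoins_eq_true_iff m]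
      constructor
      · rintro ⟨h0, h1⟩ x
        rw [← Fin.cons_self_tail x]
        cases x 0
        · exact h0 (Fin.tail x)
        · exact h1 (Fin.tail x)
      · intro h
        exact ⟨fun x => h _, fun x => h _⟩

/-- Computable test of the ring relation: the kernel-vector quantifier enumerated by `allCoins`. -/
def relB {N : ℕ} (x z : Fin N → Bool) : Bool :=
  allCoins N fun v => !decide (RingHLF.InKernel x v) || decide (RingHLF.dot2 v z = RingHLF.signBit x v)

/-- `relB` decides `RingHLF.Rel`. -/
theorem relB_eq_true_iff {N : ℕ} (x z : Fin N → Bool) : relB x z = true ↔ RingHLF.Rel x z := by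
  unfold relB RingHLF.Rel
  rw [allCoins_eq_true_iff]
  refine forall_congr' fun v => ?_
  rw [Bool.or_eq_true, Bool.not_eq_true', decide_eq_false_iff_not, decide_eq_true_eq]
  exact (imp_iff_not_or).symm

/-- Computable win test of the antipodal strategy (offset `1`) on an odd input. -/
def winB (N : ℕ) (x : Fin N → Bool) : Bool :=
  decide ((univ.filter fun b : Fin N => x b = false).card % 2 = 1) &&
    relB x (affBell (antipodalRows N) (fun _ => (1 : ZMod 3)) x)

/-- The win count of the antipodal strategy as a structural count (kernel-reducible). -/
theorem affWinCard_eq_countCoins (N : ℕ) :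
    affWinCard (antipodalRows N) (fun _ => (1 : ZMod 3)) = FreePhase.countCoins N (winB N) := by
  classical
  unfold affWinCard OddZeros
  rw [FreePhase.countCoins_eq]
  apply congrArg Finset.card
  ext x
  simp only [mem_filter, mem_univ, true_and, winB, Bool.and_eq_true, decide_eq_true_eq, relB_eq_true_iff]

/-! ### `N = 6` and `N = 8` -/

/-- **`wins(6) = 26`** (of the `32` odd inputs). -/
theorem antipodal_wins_six : affWinCard (antipodalRows 6) (fun _ => (1 : ZMod 3)) = 26 := by
  rw [affWinCard_eq_countCoins]
  decide +kernel

/-- **`wins(8) = 88`** (of the `128` odd inputs). -/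
theorem antipodal_wins_eight : affWinCard (antipodalRows 8) (fun _ => (1 : ZMod 3)) = 88 := by
  rw [affWinCard_eq_countCoins]
  decide +kernel

/-- The closed form at `N = 6`: `2⁶ + a₃ − (−2)³ − b₃ = 64 + 45 + 8 − 13 = 104 = 4·26`. -/
theorem antipodalValueFormula_six :
    (4 * (affWinCard (antipodalRows 6) (fun _ => (1 : ZMod 3)) : ℤ)) = 2 ^ 6 + luc32 (6 / 2) - (-2) ^ (6 / 2) - luc14 (6 / 2) := by
  rw [antipodal_wins_six]
  decide

/-- The closed form at `N = 8`: `2⁸ + a₄ − (−2)⁴ − b₄ = 256 + 161 − 16 − 49 = 352 = 4·88`. -/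
theorem antipodalValueFormula_eight :
    (4 * (affWinCard (antipodalRows 8) (fun _ => (1 : ZMod 3)) : ℤ)) = 2 ^ 8 + luc32 (8 / 2) - (-2) ^ (8 / 2) - luc14 (8 / 2) := by
  rw [antipodal_wins_eight]
  decide

/-- **`AntipodalLeThreeQuarters` AS TYPED IS FALSE**: at `N = 6`, `4·wins = 104 > 96 = 3·2⁵`. -/
theorem not_antipodalLeThreeQuarters : ¬ AntipodalLeThreeQuarters := by
  intro h
  have h6 := h 6 (by norm_num) (by norm_num)
  rw [antipodal_wins_six] at h6
  norm_num at h6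

/-- The repaired corollary target for P-23h: `4·wins(N) ≤ 3·2^{N−1}` for every even `N ≥ 8` (by the closed form: `0.6875, 0.746,
0.705, 0.704, 0.681, … ↓ 1/2`). -/
def AntipodalLeThreeQuartersFrom8 : Prop :=
  ∀ N : ℕ, 8 ≤ N → N % 2 = 0 → (4 * affWinCard (antipodalRows N) (fun _ => (1 : ZMod 3))) ≤ 3 * 2 ^ (N - 1)

/-- The repaired corollary at its first instance `N = 8`: `4·88 = 352 ≤ 384`. -/
theorem antipodalLeThreeQuarters_eight :
    (4 * affWinCard (antipodalRows 8) (fun _ => (1 : ZMod 3))) ≤ 3 * 2 ^ (8 - 1) := by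
  rw [antipodal_wins_eight]
  norm_num

end AffBells23

end Summit.QuantumAdvantage.AdviceFreeQNC0
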